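import Mathlib
import HarnessLib
import Literature.MathematicalPhysics.QuantumLattice.HubbardResolventJets
import Literature.Analysis.Calculus.IteratedDerivLeibnizBound

/-!
# K3 gen-8-FLOW (stmt 20437, stub (C), located item #20, cure (δ′) «LAST-STEP SWAP», response door layer B1): the THREE DRESSING PROFILES ALONG THE
# OLD FERMI CURVE and their `θ`-jets — first / second / third order in the dressing parameter `t = D/ω₀`, graded-geometric in the curve's jets

Cell gate-hubbard-kl, seat p2 g17.  On the old curve `γ_{K_{n_β}}` the new band is `e_{K_N} = −D` exactly, so the dressing parameter of the last-step
response (`…EngineLastStepFrameIdentity` §4–§5: `v = D/(−iω₀ + e_{K_N})`, `b = 2v + v²`) is a function of ONE real variable `t(θ) := D(k_F θ)/ω₀`: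
`v = −t/(t+i) = −1 + i·r(t)` with the unit resolvent `r(t) = 1/(t + i) = resolventFnXi 1 0 (−1) t` (`‖r^{(m)}‖ ≤ m!`, `HubbardResolventJets`), hence
`b = −1 − r(t)²`, and with `ι := Im r = −1/(1+t²)`:

  `Im b = t·(2ι²)`,   `Re b = t²·(ι − 2ι²)`,   `Re(D·v) = ω₀·t³·ι`     (FIRST / SECOND / THIRD order in `t`).

This file bounds the `θ`-jets (`k ≤ 4`) of the three profiles `θ ↦ t·(2ι(t)²)`, `t²·(ι(t) − 2ι(t)²)`, `t³·ι(t)` for ANY `C⁴` scalar `t : ℝ → ℝ` with a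
GRADED-GEOMETRIC jet table at the point: `|t θ| ≤ η₀`, `|t^{(i)} θ| ≤ η·lⁱ` (`1 ≤ i ≤ 4`), `η₀ + η ≤ 1 ≤ l` — the orders of smallness `(η₀+η)`,
`(η₀+η)²`, `(η₀+η)³` survive every derivative, each derivative costs `l` (Mathlib's Faà di Bruno bound `norm_iteratedFDeriv_comp_le` for `ι = Im r ∘ t`,
the tree's geometric Leibniz bound `norm_iteratedDeriv_mul_le_of_geometric`).  Constants are generous absolute numerals.

* §1 the unit resolvent `r = resolventFnXi 1 0 (−1)`: `r t = (t + i)⁻¹`, `Im r t = −1/(1+t²)`, the three algebraic identities (`re/im` of `−1 − r²` and of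
  `t·(−1 + i·r)` in terms of `ι`), `‖D^m (Im r)‖ ≤ m!`;
* §2 `abs_iteratedDeriv_iota_comp_le` — `|∂ᵏ(ι∘t)(θ)| ≤ 576·lᵏ` (`k ≤ 4`);
* §3 **`abs_iteratedDeriv_lastProfileIm_le`**, **`…Re_le`**, **`…A_le`** — `|∂ᵏ[t·2ι²]| ≤ 2²⁸·(η₀+η)·lᵏ`, `|∂ᵏ[t²(ι−2ι²)]| ≤ 2³²·(η₀+η)²·lᵏ`,
  `|∂ᵏ[t³ι]| ≤ 2²²·(η₀+η)³·lᵏ` (`k ≤ 4`).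

Pure one-variable calculus; no definitions; nothing about the Hubbard model is asserted; nothing asserts superconductivity.
References: BGM 2006 §2.2 (2.23), §2.4 (2.36) [cite: BenfattoGiulianiMastropietro2006]; FST 1996 §1 [cite: FeldmanSalmhoferTrubowitz1996].
-/

noncomputable section

namespace Summit.HubbardSuperconductivity.HubbardSuperconductivity.Theorems.EngineV8

set_option linter.dupNamespace false -- summit = problem name (single-conjunct summit), D-0017

open Complex Real Literature.MathematicalPhysics.QuantumLattice Literature.Analysis.Calculus
open scoped Nat

/-! ## §1 The unit resolvent `r(t) = (t + i)⁻¹` and the profile identities -/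

/-- `r t = resolventFnXi 1 0 (−1) t = 1/(t + i)`. -/
theorem unitResolvent_eq (t : ℝ) : resolventFnXi 1 0 (-1) t = 1 / ((t : ℂ) + I) := by
  unfold resolventFnXi
  congr 1
  push_cast
  ring

/-- `r t = (t − i)/(1 + t²)` — real and imaginary parts: `Re r = t/(1+t²)`, `Im r = −1/(1+t²)`. -/
theorem unitResolvent_re_im (t : ℝ) :
    (resolventFnXi 1 0 (-1) t).re = t / (1 + t ^ 2) ∧ (resolventFnXi 1 0 (-1) t).im = -1 / (1 + t ^ 2) := by
  rw [unitResolvent_eq]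
  have h : (1 : ℂ) / ((t : ℂ) + I) = ((t / (1 + t ^ 2) : ℝ) : ℂ) + ((-1 / (1 + t ^ 2) : ℝ) : ℂ) * I := by
    have hne : (t : ℂ) + I ≠ 0 := by
      intro h; have := congrArg Complex.im h; simp at this
    have h1 : (1 + (t : ℂ) ^ 2) ≠ 0 := by
      have : (1 + (t : ℂ) ^ 2) = (((1 + t ^ 2 : ℝ)) : ℂ) := by push_cast; ring
      rw [this]; exact_mod_cast (by positivity : (1 + t ^ 2 : ℝ) ≠ 0)
    rw [div_eq_iff hne]
    push_cast
    field_simp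
    ring_nf
    rw [Complex.I_sq]
    ring
  rw [h, Complex.add_re, Complex.add_im, Complex.ofReal_re, Complex.ofReal_im, Complex.mul_re, Complex.mul_im, Complex.ofReal_re,
    Complex.ofReal_im, Complex.I_re, Complex.I_im]
  constructor <;> ring

/-- **The three profile identities.**  With `r = r(t)`, `ι = Im r = −1/(1+t²)`:
`Im(−1 − r²) = t·(2ι²)`, `Re(−1 − r²) = t²·(ι − 2ι²)`, `Re(t·(−1 + i·r)) = t³·ι`. -/
theorem lastProfile_identities (t : ℝ) :
    (-1 - (resolventFnXi 1 0 (-1) t) ^ 2).im = t * (2 * (resolventFnXi 1 0 (-1) t).im ^ 2) ∧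
    (-1 - (resolventFnXi 1 0 (-1) t) ^ 2).re = t ^ 2 * ((resolventFnXi 1 0 (-1) t).im - 2 * (resolventFnXi 1 0 (-1) t).im ^ 2) ∧
    ((t : ℂ) * (-1 + I * resolventFnXi 1 0 (-1) t)).re = t ^ 3 * (resolventFnXi 1 0 (-1) t).im := by
  obtain ⟨hre, him⟩ := unitResolvent_re_im t
  have h1 : (1 + t ^ 2 : ℝ) ≠ 0 := by positivity
  refine ⟨?_, ?_, ?_⟩
  · simp only [Complex.sub_im, Complex.neg_im, Complex.one_im, neg_zero, zero_sub, pow_two, Complex.mul_im, hre, him]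
    field_simp
    ring
  · simp only [Complex.sub_re, Complex.neg_re, Complex.one_re, pow_two, Complex.mul_re, hre, him]
    field_simp
    ring
  · simp only [Complex.mul_re, Complex.ofReal_re, Complex.ofReal_im, Complex.add_re, Complex.add_im, Complex.neg_re, Complex.one_re,
      Complex.mul_im, Complex.I_re, Complex.I_im, hre, him, zero_mul, sub_zero, one_mul, zero_add]
    field_simp
    ring

/-- `‖D^m (Im ∘ r)(t)‖ ≤ m!` everywhere (`‖r^{(m)}(t)‖ = m!/‖t+i‖^{m+1} ≤ m!`). -/
theorem norm_iteratedFDeriv_im_unitResolvent_le (m : ℕ) (t : ℝ) :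
    ‖iteratedFDeriv ℝ m (fun x : ℝ => (resolventFnXi 1 0 (-1) x).im) t‖ ≤ m ! := by
  have hω : (-1 : ℝ) + 0 ≠ 0 := by norm_num
  have hR : ContDiff ℝ ((⊤ : ℕ∞) : WithTop ℕ∞) (resolventFnXi 1 0 (-1)) := contDiff_resolventFnXi (c := 1) hω
  have hcomp : (fun x : ℝ => (resolventFnXi 1 0 (-1) x).im) = ⇑Complex.imCLM ∘ resolventFnXi 1 0 (-1) := rfl
  rw [hcomp]
  refine (Complex.imCLM.norm_iteratedFDeriv_comp_left hR.contDiffAt (by exact_mod_cast le_top)).trans ?_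
  rw [Complex.imCLM_norm, one_mul]
  refine (norm_iteratedFDeriv_resolventFnXi_le (c := 1) hω m t).trans ?_
  rw [abs_one, one_mul, show |(-1 : ℝ) + 0| = 1 by norm_num, one_pow, div_one]

/-- `Im ∘ r` is `C^∞`. -/
theorem contDiff_im_unitResolvent {N : WithTop ℕ∞} : ContDiff ℝ N (fun x : ℝ => (resolventFnXi 1 0 (-1) x).im) :=
  Complex.imCLM.contDiff.comp (contDiff_resolventFnXi (c := 1) (θ := 0) (ω := -1) (by norm_num))

/-- `|Im r(t)| ≤ 1`. -/
theorem abs_im_unitResolvent_le_one (t : ℝ) : |(resolventFnXi 1 0 (-1) t).im| ≤ 1 := by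
  rw [(unitResolvent_re_im t).2, abs_div, abs_neg, abs_one, abs_of_pos (by positivity : (0 : ℝ) < 1 + t ^ 2)]
  rw [div_le_one (by positivity)]
  nlinarith [sq_nonneg t]

/-! ## §2 The profile `ι = Im r ∘ t` along a `C⁴` scalar `t` with a graded-geometric jet table -/

/-- The graded table as one geometric envelope: `|t^{(i)}(θ)| ≤ (η₀+η)·lⁱ` for every `i ≤ 4`. -/
theorem abs_iteratedDeriv_t_le_geometric {t : ℝ → ℝ} {η₀ η l : ℝ} (h0 : 0 ≤ η₀) (hη : 0 ≤ η) (hl : 1 ≤ l) {θ : ℝ}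
    (ht0 : |t θ| ≤ η₀) (htd : ∀ i, 1 ≤ i → i ≤ 4 → |iteratedDeriv i t θ| ≤ η * l ^ i) :
    ∀ i ≤ 4, ‖iteratedDeriv i t θ‖ ≤ (η₀ + η) * l ^ i := by
  intro i hi
  rw [Real.norm_eq_abs]
  rcases Nat.eq_zero_or_pos i with h | h
  · subst h
    rw [iteratedDeriv_zero, pow_zero, mul_one]
    linarith [ht0]
  · refine (htd i h hi).trans ?_
    have hl0 : 0 ≤ l ^ i := by positivity
    nlinarith

/-- **`|∂ᵏ(ι∘t)(θ)| ≤ 576·lᵏ`** for `k ≤ 4` (Faà di Bruno: `k!·(max_m m!)·lᵏ ≤ 24·24·lᵏ`; the pure powers `lⁱ` dominate the graded table since `η ≤ 1`). -/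
theorem abs_iteratedDeriv_iota_comp_le {t : ℝ → ℝ} (ht : ContDiff ℝ 4 t) {η₀ η l : ℝ} (h0 : 0 ≤ η₀) (h1 : η₀ + η ≤ 1) (hl : 1 ≤ l) {θ : ℝ}
    (htd : ∀ i, 1 ≤ i → i ≤ 4 → |iteratedDeriv i t θ| ≤ η * l ^ i) :
    ∀ k ≤ 4, ‖iteratedDeriv k (fun θ => (resolventFnXi 1 0 (-1) (t θ)).im) θ‖ ≤ 576 * l ^ k := by
  intro k hk
  have hcomp : (fun θ => (resolventFnXi 1 0 (-1) (t θ)).im) = (fun x : ℝ => (resolventFnXi 1 0 (-1) x).im) ∘ t := rfl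
  rw [← norm_iteratedFDeriv_eq_norm_iteratedDeriv, hcomp]
  have hk' : (k : WithTop ℕ∞) ≤ 4 := by exact_mod_cast hk
  have hη1 : η ≤ 1 := by linarith
  have h := norm_iteratedFDeriv_comp_le (𝕜 := ℝ) (contDiff_im_unitResolvent (N := 4)) ht hk' θ (C := 24) (D := l)
    (fun i hi => (norm_iteratedFDeriv_im_unitResolvent_le i (t θ)).trans (by
      have : i ! ≤ 4 ! := Nat.factorial_le (hi.trans hk)
      exact_mod_cast this.trans (by decide)))
    (fun i hi1 hi4 => by
      rw [norm_iteratedFDeriv_eq_norm_iteratedDeriv, Real.norm_eq_abs]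
      refine (htd i hi1 (hi4.trans hk)).trans ?_
      have hl0 : 0 ≤ l ^ i := by positivity
      nlinarith)
  refine h.trans ?_
  have hkf : (k ! : ℝ) ≤ 24 := by
    have : k ! ≤ 4 ! := Nat.factorial_le hk
    exact_mod_cast this.trans (by decide)
  have hl0 : 0 ≤ l ^ k := by positivity
  nlinarith

/-- `ι∘t` is `C⁴`. -/
theorem contDiff_iota_comp {t : ℝ → ℝ} (ht : ContDiff ℝ 4 t) : ContDiff ℝ 4 (fun θ => (resolventFnXi 1 0 (-1) (t θ)).im) :=
  (contDiff_im_unitResolvent (N := 4)).comp ht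

/-! ## §3 The three profiles -/

/-- `2·(ι∘t)²`: `|∂ᵏ| ≤ 2·2⁴·576²·lᵏ` (`k ≤ 4`). -/
theorem abs_iteratedDeriv_two_iota_sq_le {t : ℝ → ℝ} (ht : ContDiff ℝ 4 t) {η₀ η l : ℝ} (h0 : 0 ≤ η₀) (h1 : η₀ + η ≤ 1) (hl : 1 ≤ l) {θ : ℝ}
    (htd : ∀ i, 1 ≤ i → i ≤ 4 → |iteratedDeriv i t θ| ≤ η * l ^ i) :
    ∀ k ≤ 4, ‖iteratedDeriv k (fun θ => 2 * (resolventFnXi 1 0 (-1) (t θ)).im ^ 2) θ‖ ≤ 2 * 2 ^ 4 * 576 ^ 2 * l ^ k := by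
  intro k hk
  have hι := contDiff_iota_comp ht
  have hk' : (k : WithTop ℕ∞) ≤ 4 := by exact_mod_cast hk
  have hl0' : (0 : ℝ) ≤ l := by linarith
  have hsq : ‖iteratedDeriv k (fun θ => (resolventFnXi 1 0 (-1) (t θ)).im * (resolventFnXi 1 0 (-1) (t θ)).im) θ‖ ≤ 2 ^ k * 576 * 576 * l ^ k :=
    norm_iteratedDeriv_mul_le_of_geometric (hι.of_le hk') (hι.of_le hk') θ hl0'
      (fun i hi => abs_iteratedDeriv_iota_comp_le ht h0 h1 hl htd i (hi.trans hk))
      (fun i hi => abs_iteratedDeriv_iota_comp_le ht h0 h1 hl htd i (hi.trans hk))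
  have hfun : (fun θ => 2 * (resolventFnXi 1 0 (-1) (t θ)).im ^ 2) =
      fun θ => (2 : ℝ) * ((resolventFnXi 1 0 (-1) (t θ)).im * (resolventFnXi 1 0 (-1) (t θ)).im) := by
    funext θ; ring
  rw [hfun]
  refine (norm_iteratedDeriv_const_mul_le ((hι.mul hι).of_le hk') (2 : ℝ) θ).trans ?_
  rw [Real.norm_eq_abs, abs_two]
  have h2k : (2 : ℝ) ^ k ≤ 2 ^ 4 := pow_le_pow_right₀ (by norm_num) hk
  have hl0 : 0 ≤ l ^ k := by positivity
  nlinarith [hsq, mul_le_mul_of_nonneg_right h2k (by positivity : (0 : ℝ) ≤ 576 * 576 * l ^ k)]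

/-- `ι∘t − 2(ι∘t)²`: `|∂ᵏ| ≤ (576 + 2·2⁴·576²)·lᵏ` (`k ≤ 4`). -/
theorem abs_iteratedDeriv_iota_sub_le {t : ℝ → ℝ} (ht : ContDiff ℝ 4 t) {η₀ η l : ℝ} (h0 : 0 ≤ η₀) (h1 : η₀ + η ≤ 1) (hl : 1 ≤ l) {θ : ℝ}
    (htd : ∀ i, 1 ≤ i → i ≤ 4 → |iteratedDeriv i t θ| ≤ η * l ^ i) :
    ∀ k ≤ 4, ‖iteratedDeriv k (fun θ => (resolventFnXi 1 0 (-1) (t θ)).im - 2 * (resolventFnXi 1 0 (-1) (t θ)).im ^ 2) θ‖ ≤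
      (576 + 2 * 2 ^ 4 * 576 ^ 2) * l ^ k := by
  intro k hk
  have hι := contDiff_iota_comp ht
  have hk' : (k : WithTop ℕ∞) ≤ 4 := by exact_mod_cast hk
  have h2 : ContDiff ℝ 4 (fun θ => 2 * (resolventFnXi 1 0 (-1) (t θ)).im ^ 2) := contDiff_const.mul (hι.pow 2)
  have hfun : (fun θ => (resolventFnXi 1 0 (-1) (t θ)).im - 2 * (resolventFnXi 1 0 (-1) (t θ)).im ^ 2) =
      (fun θ => (resolventFnXi 1 0 (-1) (t θ)).im) - fun θ => 2 * (resolventFnXi 1 0 (-1) (t θ)).im ^ 2 := rfl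
  rw [hfun, iteratedDeriv_sub (hι.contDiffAt.of_le hk') (h2.contDiffAt.of_le hk')]
  refine (norm_sub_le _ _).trans ?_
  have ha := abs_iteratedDeriv_iota_comp_le ht h0 h1 hl htd k hk
  have hb := abs_iteratedDeriv_two_iota_sq_le ht h0 h1 hl htd k hk
  linarith

/-- **FIRST ORDER — `Im b` along the curve**: `|∂ᵏ[t·(2ι²)](θ)| ≤ 2²⁸·(η₀+η)·lᵏ` (`k ≤ 4`). -/
theorem abs_iteratedDeriv_lastProfileIm_le {t : ℝ → ℝ} (ht : ContDiff ℝ 4 t) {η₀ η l : ℝ} (h0 : 0 ≤ η₀) (hη : 0 ≤ η) (h1 : η₀ + η ≤ 1) (hl : 1 ≤ l) {θ : ℝ}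
    (ht0 : |t θ| ≤ η₀) (htd : ∀ i, 1 ≤ i → i ≤ 4 → |iteratedDeriv i t θ| ≤ η * l ^ i) :
    ∀ k ≤ 4, |iteratedDeriv k (fun θ => t θ * (2 * (resolventFnXi 1 0 (-1) (t θ)).im ^ 2)) θ| ≤ 2 ^ 28 * (η₀ + η) * l ^ k := by
  intro k hk
  have hι := contDiff_iota_comp ht
  have hk' : (k : WithTop ℕ∞) ≤ 4 := by exact_mod_cast hk
  have hl0' : (0 : ℝ) ≤ l := by linarith
  have h2 : ContDiff ℝ 4 (fun θ => 2 * (resolventFnXi 1 0 (-1) (t θ)).im ^ 2) := contDiff_const.mul (hι.pow 2)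
  have h := norm_iteratedDeriv_mul_le_of_geometric (ht.of_le hk') (h2.of_le hk') θ hl0'
    (fun i hi => abs_iteratedDeriv_t_le_geometric h0 hη hl ht0 htd i (hi.trans hk))
    (fun i hi => abs_iteratedDeriv_two_iota_sq_le ht h0 h1 hl htd i (hi.trans hk))
  rw [Real.norm_eq_abs] at h
  refine h.trans ?_
  have h2k : (2 : ℝ) ^ k ≤ 2 ^ 4 := pow_le_pow_right₀ (by norm_num) hk
  have hpos : 0 ≤ (η₀ + η) * (2 * 2 ^ 4 * 576 ^ 2) * l ^ k := by positivity
  calc 2 ^ k * (η₀ + η) * (2 * 2 ^ 4 * 576 ^ 2) * l ^ k = 2 ^ k * ((η₀ + η) * (2 * 2 ^ 4 * 576 ^ 2) * l ^ k) := by ring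
    _ ≤ 2 ^ 4 * ((η₀ + η) * (2 * 2 ^ 4 * 576 ^ 2) * l ^ k) := mul_le_mul_of_nonneg_right h2k hpos
    _ ≤ 2 ^ 28 * (η₀ + η) * l ^ k := by nlinarith [mul_nonneg (by positivity : (0:ℝ) ≤ η₀ + η) (by positivity : (0:ℝ) ≤ l ^ k)]

/-- `t·t` at all orders `i ≤ 4`: `≤ 2⁴·(η₀+η)²·lⁱ`. -/
theorem abs_iteratedDeriv_t_sq_le {t : ℝ → ℝ} (ht : ContDiff ℝ 4 t) {η₀ η l : ℝ} (h0 : 0 ≤ η₀) (hη : 0 ≤ η) (h1 : η₀ + η ≤ 1) (hl : 1 ≤ l) {θ : ℝ}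
    (ht0 : |t θ| ≤ η₀) (htd : ∀ i, 1 ≤ i → i ≤ 4 → |iteratedDeriv i t θ| ≤ η * l ^ i) :
    ∀ i ≤ 4, ‖iteratedDeriv i (fun θ => t θ * t θ) θ‖ ≤ 2 ^ 4 * (η₀ + η) * (η₀ + η) * l ^ i := by
  intro i hi4
  have hi' : (i : WithTop ℕ∞) ≤ 4 := by exact_mod_cast hi4
  have hl0' : (0 : ℝ) ≤ l := by linarith
  have h := norm_iteratedDeriv_mul_le_of_geometric (ht.of_le hi') (ht.of_le hi') θ hl0'
    (fun j hj => abs_iteratedDeriv_t_le_geometric h0 hη hl ht0 htd j (hj.trans hi4))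
    (fun j hj => abs_iteratedDeriv_t_le_geometric h0 hη hl ht0 htd j (hj.trans hi4))
  refine h.trans ?_
  have h2i : (2 : ℝ) ^ i ≤ 2 ^ 4 := pow_le_pow_right₀ (by norm_num) hi4
  have hpos : 0 ≤ (η₀ + η) * (η₀ + η) * l ^ i := by positivity
  have h1' := h1
  nlinarith [mul_le_mul_of_nonneg_right h2i hpos]

/-- **SECOND ORDER — `Re b` along the curve**: `|∂ᵏ[t²·(ι − 2ι²)](θ)| ≤ 2³²·(η₀+η)²·lᵏ` (`k ≤ 4`). -/
theorem abs_iteratedDeriv_lastProfileRe_le {t : ℝ → ℝ} (ht : ContDiff ℝ 4 t) {η₀ η l : ℝ} (h0 : 0 ≤ η₀) (hη : 0 ≤ η) (h1 : η₀ + η ≤ 1) (hl : 1 ≤ l) {θ : ℝ}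
    (ht0 : |t θ| ≤ η₀) (htd : ∀ i, 1 ≤ i → i ≤ 4 → |iteratedDeriv i t θ| ≤ η * l ^ i) :
    ∀ k ≤ 4, |iteratedDeriv k (fun θ => t θ ^ 2 * ((resolventFnXi 1 0 (-1) (t θ)).im - 2 * (resolventFnXi 1 0 (-1) (t θ)).im ^ 2)) θ| ≤
      2 ^ 32 * (η₀ + η) ^ 2 * l ^ k := by
  intro k hk
  have hι := contDiff_iota_comp ht
  have hk' : (k : WithTop ℕ∞) ≤ 4 := by exact_mod_cast hk
  have hl0' : (0 : ℝ) ≤ l := by linarith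
  have hA : ContDiff ℝ 4 (fun θ => (resolventFnXi 1 0 (-1) (t θ)).im - 2 * (resolventFnXi 1 0 (-1) (t θ)).im ^ 2) :=
    hι.sub (contDiff_const.mul (hι.pow 2))
  have hfun : (fun θ => t θ ^ 2 * ((resolventFnXi 1 0 (-1) (t θ)).im - 2 * (resolventFnXi 1 0 (-1) (t θ)).im ^ 2)) =
      fun θ => (t θ * t θ) * ((resolventFnXi 1 0 (-1) (t θ)).im - 2 * (resolventFnXi 1 0 (-1) (t θ)).im ^ 2) := by
    funext θ; ring
  rw [hfun]
  have h := norm_iteratedDeriv_mul_le_of_geometric ((ht.mul ht).of_le hk') (hA.of_le hk') θ hl0'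
    (fun i hi => abs_iteratedDeriv_t_sq_le ht h0 hη h1 hl ht0 htd i (hi.trans hk))
    (fun i hi => abs_iteratedDeriv_iota_sub_le ht h0 h1 hl htd i (hi.trans hk))
  rw [Real.norm_eq_abs] at h
  refine h.trans ?_
  have h2k : (2 : ℝ) ^ k ≤ 2 ^ 4 := pow_le_pow_right₀ (by norm_num) hk
  have hpos : 0 ≤ (2 ^ 4 * (η₀ + η) * (η₀ + η)) * (576 + 2 * 2 ^ 4 * 576 ^ 2) * l ^ k := by positivity
  calc 2 ^ k * (2 ^ 4 * (η₀ + η) * (η₀ + η)) * (576 + 2 * 2 ^ 4 * 576 ^ 2) * l ^ k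
      = 2 ^ k * ((2 ^ 4 * (η₀ + η) * (η₀ + η)) * (576 + 2 * 2 ^ 4 * 576 ^ 2) * l ^ k) := by ring
    _ ≤ 2 ^ 4 * ((2 ^ 4 * (η₀ + η) * (η₀ + η)) * (576 + 2 * 2 ^ 4 * 576 ^ 2) * l ^ k) := mul_le_mul_of_nonneg_right h2k hpos
    _ ≤ 2 ^ 32 * (η₀ + η) ^ 2 * l ^ k := by
        rw [sq]; nlinarith [mul_nonneg (mul_nonneg (by positivity : (0:ℝ) ≤ η₀ + η) (by positivity : (0:ℝ) ≤ η₀ + η)) (by positivity : (0:ℝ) ≤ l ^ k)]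

/-- `t·t·t` at all orders `i ≤ 4`: `≤ 2⁸·(η₀+η)³·lⁱ`. -/
theorem abs_iteratedDeriv_t_cube_le {t : ℝ → ℝ} (ht : ContDiff ℝ 4 t) {η₀ η l : ℝ} (h0 : 0 ≤ η₀) (hη : 0 ≤ η) (h1 : η₀ + η ≤ 1) (hl : 1 ≤ l) {θ : ℝ}
    (ht0 : |t θ| ≤ η₀) (htd : ∀ i, 1 ≤ i → i ≤ 4 → |iteratedDeriv i t θ| ≤ η * l ^ i) :
    ∀ i ≤ 4, ‖iteratedDeriv i (fun θ => t θ * t θ * t θ) θ‖ ≤ 2 ^ 8 * (η₀ + η) * (η₀ + η) * (η₀ + η) * l ^ i := by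
  intro i hi4
  have hi' : (i : WithTop ℕ∞) ≤ 4 := by exact_mod_cast hi4
  have hl0' : (0 : ℝ) ≤ l := by linarith
  have h := norm_iteratedDeriv_mul_le_of_geometric ((ht.mul ht).of_le hi') (ht.of_le hi') θ hl0'
    (fun j hj => abs_iteratedDeriv_t_sq_le ht h0 hη h1 hl ht0 htd j (hj.trans hi4))
    (fun j hj => abs_iteratedDeriv_t_le_geometric h0 hη hl ht0 htd j (hj.trans hi4))
  refine h.trans ?_
  have h2i : (2 : ℝ) ^ i ≤ 2 ^ 4 := pow_le_pow_right₀ (by norm_num) hi4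
  have hpos : 0 ≤ (2 ^ 4 * (η₀ + η) * (η₀ + η)) * (η₀ + η) * l ^ i := by positivity
  nlinarith [mul_le_mul_of_nonneg_right h2i hpos]

/-- **THIRD ORDER — `Re(D·v)/ω₀` along the curve**: `|∂ᵏ[t³·ι](θ)| ≤ 2²²·(η₀+η)³·lᵏ` (`k ≤ 4`). -/
theorem abs_iteratedDeriv_lastProfileA_le {t : ℝ → ℝ} (ht : ContDiff ℝ 4 t) {η₀ η l : ℝ} (h0 : 0 ≤ η₀) (hη : 0 ≤ η) (h1 : η₀ + η ≤ 1) (hl : 1 ≤ l) {θ : ℝ}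
    (ht0 : |t θ| ≤ η₀) (htd : ∀ i, 1 ≤ i → i ≤ 4 → |iteratedDeriv i t θ| ≤ η * l ^ i) :
    ∀ k ≤ 4, |iteratedDeriv k (fun θ => t θ ^ 3 * (resolventFnXi 1 0 (-1) (t θ)).im) θ| ≤ 2 ^ 22 * (η₀ + η) ^ 3 * l ^ k := by
  intro k hk
  have hι := contDiff_iota_comp ht
  have hk' : (k : WithTop ℕ∞) ≤ 4 := by exact_mod_cast hk
  have hl0' : (0 : ℝ) ≤ l := by linarith
  have hfun : (fun θ => t θ ^ 3 * (resolventFnXi 1 0 (-1) (t θ)).im) = fun θ => (t θ * t θ * t θ) * (resolventFnXi 1 0 (-1) (t θ)).im := by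
    funext θ; ring
  rw [hfun]
  have h := norm_iteratedDeriv_mul_le_of_geometric (((ht.mul ht).mul ht).of_le hk') (hι.of_le hk') θ hl0'
    (fun i hi => abs_iteratedDeriv_t_cube_le ht h0 hη h1 hl ht0 htd i (hi.trans hk)) (fun i hi => abs_iteratedDeriv_iota_comp_le ht h0 h1 hl htd i (hi.trans hk))
  rw [Real.norm_eq_abs] at h
  refine h.trans ?_
  have h2k : (2 : ℝ) ^ k ≤ 2 ^ 4 := pow_le_pow_right₀ (by norm_num) hk
  have hpos : 0 ≤ (2 ^ 8 * (η₀ + η) * (η₀ + η) * (η₀ + η)) * 576 * l ^ k := by positivity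
  calc 2 ^ k * (2 ^ 8 * (η₀ + η) * (η₀ + η) * (η₀ + η)) * 576 * l ^ k
      = 2 ^ k * ((2 ^ 8 * (η₀ + η) * (η₀ + η) * (η₀ + η)) * 576 * l ^ k) := by ring
    _ ≤ 2 ^ 4 * ((2 ^ 8 * (η₀ + η) * (η₀ + η) * (η₀ + η)) * 576 * l ^ k) := mul_le_mul_of_nonneg_right h2k hpos
    _ ≤ 2 ^ 22 * (η₀ + η) ^ 3 * l ^ k := by
        have h3 : (η₀ + η) ^ 3 = (η₀ + η) * (η₀ + η) * (η₀ + η) := by ring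
        rw [h3]
        nlinarith [mul_nonneg (mul_nonneg (mul_nonneg (by positivity : (0:ℝ) ≤ η₀ + η) (by positivity : (0:ℝ) ≤ η₀ + η))
          (by positivity : (0:ℝ) ≤ η₀ + η)) (by positivity : (0:ℝ) ≤ l ^ k)]

/-- All three profiles are `C⁴`. -/
theorem contDiff_lastProfiles {t : ℝ → ℝ} (ht : ContDiff ℝ 4 t) :
    ContDiff ℝ 4 (fun θ => t θ * (2 * (resolventFnXi 1 0 (-1) (t θ)).im ^ 2)) ∧
    ContDiff ℝ 4 (fun θ => t θ ^ 2 * ((resolventFnXi 1 0 (-1) (t θ)).im - 2 * (resolventFnXi 1 0 (-1) (t θ)).im ^ 2)) ∧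
    ContDiff ℝ 4 (fun θ => t θ ^ 3 * (resolventFnXi 1 0 (-1) (t θ)).im) := by
  have hι := contDiff_iota_comp ht
  exact ⟨ht.mul (contDiff_const.mul (hι.pow 2)), (ht.pow 2).mul (hι.sub (contDiff_const.mul (hι.pow 2))), (ht.pow 3).mul hι⟩

end Summit.HubbardSuperconductivity.HubbardSuperconductivity.Theorems.EngineV8

end
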